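import Summits.HodgeConjecture.HodgeConjecture.Theses.PeriodDeficiency
import Literature.AlgebraicGeometry.HodgeTheory.HodgeLocus
import Literature.AlgebraicGeometry.HodgeTheory.HodgeGenericQbarDescentProofs
import Literature.AlgebraicGeometry.Motives.AtypicalHodgeLocus
import Literature.AlgebraicGeometry.Motives.BaseChange
import HarnessLib

/-!
# Galois conjugation preserves irreducible Zariski-closed sets of complex points

Helper for the crux `QbarGenericIsHodgeGeneric` (stmt-HodgeConjecture-11595), line `registered`,
stubs 2–3 (fields of definition of special subvarieties): for `S = S₀ ⊗_{K,σ} ℂ` and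
`τ ∈ Aut(ℂ/σK)`, the conjugation `s ↦ τ · s` of `S(ℂ)` (`HodgeTheory.conjPoint`) is continuous for
the Zariski topology on `S(ℂ)` (`Motives.ZariskiPoints`: induced from the scheme `S` along
`P ↦ P.pt`), because on underlying points it is the scheme automorphism `𝟙 ×_K Spec τ⁻¹` of
`S₀ ×_K Spec ℂ` (`HodgeTheory.pt_conjPoint_eq`, Lang III §4: "`A^σ` is the set of points `(x^σ)`").
Consequently `τ · —` maps Zariski-closed sets of points to Zariski-closed sets of points and
irreducible ones to irreducible ones: the Galois conjugate of (the complex points of) an irreducible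
closed subvariety of `S` is again one — the first step of every field-of-definition argument for
special subvarieties (Klingler–Otwinowska–Urbanik 2023, §1.2; Voisin 2007, Lemma 1.4).

The last declaration `stub_conj_irredClosed` is the registered stub (i) of the crux skeleton
`Cruxes/QbarGenericIsHodgeGeneric/Lines/birth.lean` (reshape r2), verbatim.

## References
* [Lang1958IAG] S. Lang, *Introduction to Algebraic Geometry* (1958), Ch. III §4–§5.
-/

-- every declaration of this problem lives in `Summit.HodgeConjecture.HodgeConjecture.…`
set_option linter.dupNamespace false

noncomputable section

namespace Summit.HodgeConjecture.HodgeConjecture.Theorems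

open CategoryTheory CategoryTheory.Limits AlgebraicGeometry
open Literature.AlgebraicGeometry.Motives Literature.AlgebraicGeometry.HodgeTheory

universe u

section Twist

variable {K : Type} [Field K] (σ : K →+* ℂ) (S₀ : SchemeOver K)

/-- **The Galois twist `𝟙 ×_K Spec τ⁻¹` of `S₀ ×_K Spec ℂ` exists**: for `τ ∈ Aut(ℂ/σK)` there is
an endomorphism `ψ` of the `K`-scheme `S₀ ×_K Spec ℂ` over `S₀` covering `Spec τ⁻¹` on the second
factor — the shape consumed by `HodgeTheory.pt_conjPoint_eq` (Lang III §4). [cite: Lang1958IAG, Ch. III §4] -/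
theorem exists_galoisTwist (τ : ringAutOver σ) :
    ∃ ψ : pullback S₀.hom (Spec.map (CommRingCat.ofHom σ)) ⟶
        pullback S₀.hom (Spec.map (CommRingCat.ofHom σ)),
      ψ ≫ pullback.fst _ _ = pullback.fst _ _ ∧
      ψ ≫ pullback.snd _ _ = pullback.snd _ _ ≫
        Spec.map (CommRingCat.ofHom (letI := σ.toAlgebra; ((τ.symm : ℂ ≃ₐ[K] ℂ) : ℂ →+* ℂ))) := by
  letI := σ.toAlgebra
  have htwist : Spec.map (CommRingCat.ofHom σ) ≫ 𝟙 _ =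
      Spec.map (CommRingCat.ofHom ((τ.symm : ℂ ≃ₐ[K] ℂ) : ℂ →+* ℂ)) ≫
        Spec.map (CommRingCat.ofHom σ) := by
    rw [Category.comp_id, ← Spec.map_comp, ← CommRingCat.ofHom_comp]
    congr 2
    ext a
    exact ((τ.symm : ℂ ≃ₐ[K] ℂ).commutes a).symm
  refine ⟨pullback.map _ _ _ _ (𝟙 _)
      (Spec.map (CommRingCat.ofHom ((τ.symm : ℂ ≃ₐ[K] ℂ) : ℂ →+* ℂ))) (𝟙 _) (by simp) htwist,
    ?_, ?_⟩
  · exact (pullback.lift_fst _ _ _).trans (Category.comp_id _)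
  · exact pullback.lift_snd _ _ _

/-- **Conjugation is Zariski-continuous on complex points**: for `τ ∈ Aut(ℂ/σK)` the map
`s ↦ τ · s` of `S(ℂ)`, `S = S₀ ⊗_{K,σ} ℂ`, is continuous for the Zariski topology on `S(ℂ)`
(induced from the scheme `S` along `P ↦ P.pt`), since `(τ · s).pt = ψ(s.pt)` for the scheme
endomorphism `ψ = 𝟙 ×_K Spec τ⁻¹` (`pt_conjPoint_eq`). [cite: Lang1958IAG, Ch. III §4] -/
theorem continuous_conjPoint_zariski (τ : ringAutOver σ) :
    Continuous fun P : ZariskiPoints ((baseChangeHom σ).obj S₀) ℂ =>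
      (show ZariskiPoints ((baseChangeHom σ).obj S₀) ℂ from conjPoint σ S₀ τ P.val) := by
  obtain ⟨ψ, h1, h2⟩ := exists_galoisTwist σ S₀ τ
  refine continuous_induced_rng.2 ?_
  have key : ((fun P : ZariskiPoints ((baseChangeHom σ).obj S₀) ℂ => P.val.pt) ∘ fun P =>
      (show ZariskiPoints ((baseChangeHom σ).obj S₀) ℂ from conjPoint σ S₀ τ P.val)) =
      fun P : ZariskiPoints ((baseChangeHom σ).obj S₀) ℂ => ψ.base P.val.pt := by
    funext P
    exact pt_conjPoint_eq σ S₀ τ P.val ψ h1 h2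
  rw [key]
  exact ψ.base.hom.continuous.comp continuous_induced_dom

/-- `τ⁻¹ · (τ · s) = s`. [folklore] -/
theorem conjPoint_inv_conjPoint (τ : ringAutOver σ)
    (s : ComplexPoints ((baseChangeHom σ).obj S₀)) : conjPoint σ S₀ τ⁻¹ (conjPoint σ S₀ τ s) = s := by
  rw [← conjPoint_mul, inv_mul_cancel, conjPoint_one]

/-- `τ · (τ⁻¹ · s) = s`. [folklore] -/
theorem conjPoint_conjPoint_inv (τ : ringAutOver σ)
    (s : ComplexPoints ((baseChangeHom σ).obj S₀)) : conjPoint σ S₀ τ (conjPoint σ S₀ τ⁻¹ s) = s := by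
  rw [← conjPoint_mul, mul_inv_cancel, conjPoint_one]

/-- The conjugate `τ · A` of a set of complex points is the preimage of `A` under `τ⁻¹ · —`.
[folklore] -/
theorem image_conjPoint_eq_preimage (τ : ringAutOver σ)
    (A : Set (ComplexPoints ((baseChangeHom σ).obj S₀))) :
    conjPoint σ S₀ τ '' A = conjPoint σ S₀ τ⁻¹ ⁻¹' A :=
  congrFun (Set.image_eq_preimage_of_inverse
    (conjPoint_inv_conjPoint σ S₀ τ) (conjPoint_conjPoint_inv σ S₀ τ)) A

/-- **Galois conjugation preserves Zariski-closed sets of complex points**: if `A ⊆ S(ℂ)` is the set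
of complex points of a closed subset of `S = S₀ ⊗_{K,σ} ℂ` (`Motives.IsZariskiClosedOnPoints`), so is
`τ · A` for every `τ ∈ Aut(ℂ/σK)` (Lang III §4: `A^σ` is again an algebraic set).
[cite: Lang1958IAG, Ch. III §4] -/
theorem isZariskiClosedOnPoints_image_conjPoint (τ : ringAutOver σ)
    {A : Set (ComplexPoints ((baseChangeHom σ).obj S₀))}
    (hA : IsZariskiClosedOnPoints ((baseChangeHom σ).obj S₀) A) :
    IsZariskiClosedOnPoints ((baseChangeHom σ).obj S₀) (conjPoint σ S₀ τ '' A) := by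
  rw [isZariskiClosedOnPoints_iff_isClosed] at hA ⊢
  rw [image_conjPoint_eq_preimage]
  exact hA.preimage (continuous_conjPoint_zariski σ S₀ τ⁻¹)

/-- On `S(ℂ)` with the Zariski topology, `τ · A` is the image of `A` under the (Zariski-continuous)
conjugation map. [folklore] -/
theorem zariskiSet_image_conjPoint (τ : ringAutOver σ)
    (A : Set (ComplexPoints ((baseChangeHom σ).obj S₀))) :
    zariskiSet ((baseChangeHom σ).obj S₀) (conjPoint σ S₀ τ '' A) =
      (fun P : ZariskiPoints ((baseChangeHom σ).obj S₀) ℂ =>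
        (show ZariskiPoints ((baseChangeHom σ).obj S₀) ℂ from conjPoint σ S₀ τ P.val)) ''
        zariskiSet ((baseChangeHom σ).obj S₀) A := by
  ext P
  exact Iff.rfl

/-- **Galois conjugation preserves irreducibility of sets of complex points** (for the Zariski
topology on `S(ℂ)`): the continuous image of an irreducible set is irreducible.
[cite: Lang1958IAG, Ch. III §4] -/
theorem isIrreducible_zariskiSet_image_conjPoint (τ : ringAutOver σ)
    {A : Set (ComplexPoints ((baseChangeHom σ).obj S₀))}
    (hA : IsIrreducible (zariskiSet ((baseChangeHom σ).obj S₀) A)) :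
    IsIrreducible (zariskiSet ((baseChangeHom σ).obj S₀) (conjPoint σ S₀ τ '' A)) := by
  rw [zariskiSet_image_conjPoint]
  exact hA.image _ (continuous_conjPoint_zariski σ S₀ τ).continuousOn

/-- **The Galois conjugate of an irreducible closed subvariety (on complex points) is an irreducible
closed subvariety**: for `S = S₀ ⊗_{K,σ} ℂ`, `τ ∈ Aut(ℂ/σK)` and `A ⊆ S(ℂ)` irreducible and Zariski
closed on points (`Motives.IsIrreducibleZariskiClosedOnPoints`), so is `τ · A`. This is the first
step of the field-of-definition arguments for special subvarieties (the conjugate of a special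
subvariety is a candidate special subvariety). [cite: Lang1958IAG, Ch. III §4] -/
theorem isIrreducibleZariskiClosedOnPoints_image_conjPoint (τ : ringAutOver σ)
    {A : Set (ComplexPoints ((baseChangeHom σ).obj S₀))}
    (hA : IsIrreducibleZariskiClosedOnPoints ((baseChangeHom σ).obj S₀) A) :
    IsIrreducibleZariskiClosedOnPoints ((baseChangeHom σ).obj S₀) (conjPoint σ S₀ τ '' A) :=
  ⟨(isZariskiClosedOnPoints_iff_isClosed _).1
      (isZariskiClosedOnPoints_image_conjPoint σ S₀ τ ((isZariskiClosedOnPoints_iff_isClosed _).2 hA.1)),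
    isIrreducible_zariskiSet_image_conjPoint σ S₀ τ hA.2⟩

/-- `τ · —` is strictly monotone on strict inclusions of sets of complex points: `A ⊂ B` gives
`τ · A ⊂ τ · B` (conjugation is a bijection of `S(ℂ)`). [folklore] -/
theorem image_conjPoint_ssubset (τ : ringAutOver σ)
    {A B : Set (ComplexPoints ((baseChangeHom σ).obj S₀))} (h : A ⊂ B) :
    conjPoint σ S₀ τ '' A ⊂ conjPoint σ S₀ τ '' B :=
  (Function.LeftInverse.injective (conjPoint_inv_conjPoint σ S₀ τ)).image_strictMono h

/-- **A Zariski-closed irreducible set of complex points stable under `Aut(ℂ/ℚ̄)` is defined over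
`ℚ̄`** — the form in which `IsDefinedOverQbar` is established for a special subvariety `Y`: it
suffices to show `τ · Y ⊆ Y` for the automorphisms of `ℂ` fixing `ℚ̄ ⊆ ℂ` pointwise.
[cite: Lang1958IAG, Ch. III §5, C4–C7] -/
theorem isDefinedOverQbar_of_forall_image_conjPoint_subset {σ : AlgebraicClosure ℚ →+* ℂ}
    {S₀ : SchemeOver (AlgebraicClosure ℚ)} {Y : Set (ComplexPoints ((baseChangeHom σ).obj S₀))}
    (hY : IsIrreducibleZariskiClosedOnPoints ((baseChangeHom σ).obj S₀) Y)
    (hstab : ∀ τ : ringAutOver σ, (∀ z ∈ (algebraicClosure ℚ ℂ).toSubfield, τ z = z) →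
      conjPoint σ S₀ τ '' Y ⊆ Y) :
    IsDefinedOverQbar σ S₀ Y :=
  ⟨(isZariskiClosedOnPoints_iff_isClosed _).2 hY.1, hstab⟩

end Twist

/-! ### The registered stub of the crux skeleton (reshape r2) -/

/-- **Registered stub `stub_conj_irredClosed` of the crux skeleton `QbarGenericIsHodgeGeneric`
(line `registered`, reshape r2):** Galois conjugation by `τ ∈ Aut(ℂ/ℚ̄)` transports irreducible
Zariski-closed sets of complex points of `S₀ ⊗_σ ℂ` (`isIrreducibleZariskiClosedOnPoints_image_conjPoint`
specialised to `K = ℚ̄`). [cite: Lang1958IAG, Ch. III §4] -/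
theorem stub_conj_irredClosed :
    ∀ (σ : AlgebraicClosure ℚ →+* ℂ) ⦃S₀ : SchemeOver (AlgebraicClosure ℚ)⦄ (τ : ringAutOver σ)
      (A : Set (ComplexPoints ((baseChangeHom σ).obj S₀))),
      IsIrreducibleZariskiClosedOnPoints ((baseChangeHom σ).obj S₀) A →
      IsIrreducibleZariskiClosedOnPoints ((baseChangeHom σ).obj S₀) (conjPoint σ S₀ τ '' A) :=
  fun σ S₀ τ _ hA => isIrreducibleZariskiClosedOnPoints_image_conjPoint σ S₀ τ hA

end Summit.HodgeConjecture.HodgeConjecture.Theorems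

end
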